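import Literature.Computability.Complexity.CircuitSemantics
import Literature.Computability.AlgebraicComplexity.ArithCircuitProofs
import Literature.Computability.AlgebraicComplexity.ValiantClasses
import Mathlib.Algebra.MvPolynomial.CommRing
import Mathlib.Algebra.MvPolynomial.Degrees
import Mathlib.RingTheory.MvPolynomial.Homogeneous
import Mathlib.Data.List.GetD
import Mathlib.Algebra.MvPolynomial.Monad
import HarnessLib

/-!
# Arithmetization of Boolean circuits (Valiant's criterion, the transcript sum)

For a Boolean circuit `Q` on inputs `ι` with gates of fan-in `≤ 2` (the library's
`Literature.Computability.Complexity.Circuit`, basis `B₂`) we construct a polynomial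
`arith Q ∈ k[X_ι, Y_1, …, Y_s]` (`s = |Q|`) over any commutative ring `k` such that

* (`sum_eval_arith`) for every Boolean input `b`,
  `∑_{y ∈ {0,1}^s} arith Q (b, y) = [Q(b) = 1]`;
* (`complexity_arith_le`, `totalDegree_arith_le`) `arith Q` has arithmetic circuits of size
  `O(s)` and degree `O(s)`.

This is the standard "transcript" arithmetization behind Valiant's criterion (Valiant 1979;
Bürgisser 2000, Prop. 2.20; Tavenas 2014, Prop. 3.10): `arith Q = VALID · OUT`, where
`VALID = ∏_j [Y_j = T_j(args)]` is the product over the gates of the multilinear indicator that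
the guessed gate value `Y_j` equals the gate's truth table `T_j` applied to its (input or earlier
gate) arguments, and `OUT` is the output wire; on Boolean points `VALID` is the indicator of the
unique correct transcript `y = wireVals Q b` (`eval_validPoly`, through the gate-by-gate semantics
`transcript` and the uniqueness `eq_transcript_of_gate_equations` of `CircuitSemantics.lean`), so the Boolean sum collapses to
the value of the output wire.

## Main definitions and statements

* `CircuitArith.lit`, `tableExt`, `eqInd`: Boolean literals, the multilinear extension of a
  binary truth table, the equality indicator; `wirePoly`, `consPoly`, `validPoly`, `arith`.
* `CircuitArith.eval_validPoly`: `VALID(b, y) = [ofFn y = wireVals]`.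
* `CircuitArith.sum_eval_arith`: the transcript sum.
* `CircuitArith.complexity_arith_le : complexity (arith Q) ≤ 60 |Q| + 1`,
  `CircuitArith.totalDegree_arith_le : deg (arith Q) ≤ 3 |Q| + 1`.
* `CircuitArith.eval_boolSum_arith`: the criterion in the library's `boolSum` form
  (`ValiantClasses.lean`): `boolSum (arith Q)` evaluates to `[Q(b)]` at `b`.

## References

* L. G. Valiant, *Completeness classes in algebra*, STOC 1979, §4 (the criterion).
* P. Bürgisser, *Completeness and Reduction in Algebraic Complexity Theory*, Springer 2000,
  Prop. 2.20 (Valiant's criterion) and its proof.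
* S. Tavenas, PhD thesis, ENS Lyon 2014, Prop. 3.10.
* S. Arora, B. Barak, *Computational Complexity* (2009), Def. 6.1, Rem. 6.4 (circuits as
  straight-line programs).
-/

noncomputable section

open MvPolynomial

universe u v w

namespace Literature.Computability.AlgebraicComplexity

open Complexity

namespace CircuitArith

variable {k : Type u} [CommRing k] {τ : Type w}

/-! ### Boolean gadgets -/

/-- `0/1` embedding of a Boolean. [folklore] -/
def toK (k : Type u) [CommRing k] (b : Bool) : k := if b then 1 else 0

/-- `toK true = 1`. [folklore] -/
@[simp] theorem toK_true : toK k true = 1 := rfl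

/-- `toK false = 0`. [folklore] -/
@[simp] theorem toK_false : toK k false = 0 := rfl

/-- The literal `p` (if `c`) or `1 - p` (if `¬c`). [cite: Burgisser2000, proof of Prop. 2.20] -/
def lit (c : Bool) (p : MvPolynomial τ k) : MvPolynomial τ k := if c then p else 1 - p

/-- The multilinear extension of a binary truth table `T`:
`∑_{b₀ b₁} [T b₀ b₁] · lit b₀ u · lit b₁ v`. [cite: Burgisser2000, proof of Prop. 2.20] -/
def tableExt (T : Bool → Bool → Bool) (u v : MvPolynomial τ k) : MvPolynomial τ k :=
  ∑ b0 : Bool, ∑ b1 : Bool, if T b0 b1 then lit b0 u * lit b1 v else 0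

/-- The equality indicator `y t + (1 - y)(1 - t)` of two Boolean-valued polynomials. [cite: Burgisser2000, proof of Prop. 2.20] -/
def eqInd (y t : MvPolynomial τ k) : MvPolynomial τ k := y * t + (1 - y) * (1 - t)

/-- `lit c p` at a point where `p` is Boolean. [folklore] -/
theorem eval_lit (x : τ → k) (c v : Bool) (p : MvPolynomial τ k) (hp : eval x p = toK k v) :
    eval x (lit c p) = toK k (v == c) := by
  unfold lit
  cases c <;> cases v <;> simp [hp, toK]

/-- `tableExt T u v` at a point where `u, v` are Boolean is `T` of their values. [cite: Burgisser2000, proof of Prop. 2.20] -/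
theorem eval_tableExt (x : τ → k) (T : Bool → Bool → Bool) (u v : MvPolynomial τ k) (bu bv : Bool)
    (hu : eval x u = toK k bu) (hv : eval x v = toK k bv) : eval x (tableExt T u v) = toK k (T bu bv) := by
  unfold tableExt
  simp only [map_sum]
  have h : ∀ b0 b1 : Bool, eval x (if T b0 b1 then lit b0 u * lit b1 v else 0) =
      if T b0 b1 ∧ bu = b0 ∧ bv = b1 then (1 : k) else 0 := by
    intro b0 b1
    split_ifs with h1 h2 h2
    · rw [map_mul, eval_lit x b0 bu u hu, eval_lit x b1 bv v hv]
      obtain ⟨-, rfl, rfl⟩ := h2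
      simp [toK]
    · rw [map_mul, eval_lit x b0 bu u hu, eval_lit x b1 bv v hv]
      have : ¬ (bu = b0 ∧ bv = b1) := fun h => h2 ⟨h1, h⟩
      cases bu <;> cases bv <;> cases b0 <;> cases b1 <;> simp [toK] at this ⊢
    · exact absurd h2.1 h1
    · simp
  simp only [h, Fintype.sum_bool]
  cases bu <;> cases bv <;> cases T false false <;> cases T false true <;> cases T true false <;>
    cases T true true <;> simp [toK]

/-- `eqInd y t` at a point where `y, t` are Boolean is the indicator of equality. [cite: Burgisser2000, proof of Prop. 2.20] -/
theorem eval_eqInd (x : τ → k) (y t : MvPolynomial τ k) (by_ bt : Bool) (hy : eval x y = toK k by_)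
    (ht : eval x t = toK k bt) : eval x (eqInd y t) = toK k (by_ == bt) := by
  unfold eqInd
  cases by_ <;> cases bt <;> simp [hy, ht, toK]

/-! ### Complexity and degree of the gadgets -/

/-- `L(1 - p) ≤ L(p) + 2`. [cite: Burgisser2000, Def. 2.1] -/
theorem complexity_one_sub_le (p : MvPolynomial τ k) : complexity (1 - p) ≤ complexity p + 2 := by
  have h : (1 - p : MvPolynomial τ k) = C 1 + (-1 : k) • p := by
    rw [neg_one_smul, C_1, sub_eq_add_neg]
  rw [h]
  have h1 := complexity_add_le_holds (C (1 : k) : MvPolynomial τ k) ((-1 : k) • p)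
  have h2 := complexity_smul_le_holds (σ := τ) (-1 : k) p
  have h3 : complexity (C (1 : k) : MvPolynomial τ k) = 0 := complexity_C_holds (1 : k)
  omega

/-- `L(lit c p) ≤ L(p) + 2`. [cite: Burgisser2000, Def. 2.1] -/
theorem complexity_lit_le (c : Bool) (p : MvPolynomial τ k) : complexity (lit c p) ≤ complexity p + 2 := by
  unfold lit
  cases c
  · exact complexity_one_sub_le p
  · simp

/-- `L(tableExt T u v) ≤ 4 (L u + L v) + 26`. [cite: Burgisser2000, Def. 2.1] -/
theorem complexity_tableExt_le (T : Bool → Bool → Bool) (u v : MvPolynomial τ k) :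
    complexity (tableExt T u v) ≤ 4 * (complexity u + complexity v) + 26 := by
  unfold tableExt
  have hterm : ∀ b0 b1 : Bool, complexity (if T b0 b1 then lit b0 u * lit b1 v else 0 : MvPolynomial τ k) ≤
      complexity u + complexity v + 5 := by
    intro b0 b1
    split_ifs
    · calc complexity (lit b0 u * lit b1 v) ≤ complexity (lit b0 u) + complexity (lit b1 v) + 1 :=
            complexity_mul_le_holds _ _
        _ ≤ (complexity u + 2) + (complexity v + 2) + 1 :=
            Nat.add_le_add_right (Nat.add_le_add (complexity_lit_le _ _) (complexity_lit_le _ _)) 1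
        _ = complexity u + complexity v + 5 := by ring
    · have h0 : complexity (C (0 : k) : MvPolynomial τ k) = 0 := complexity_C_holds (0 : k)
      rw [C_0] at h0
      rw [h0]; exact Nat.zero_le _
  have hinner : ∀ b0 : Bool, complexity (∑ b1 : Bool, (if T b0 b1 then lit b0 u * lit b1 v else 0 : MvPolynomial τ k)) ≤
      2 * (complexity u + complexity v + 5) + 2 := fun b0 =>
    calc complexity (∑ b1 : Bool, (if T b0 b1 then lit b0 u * lit b1 v else 0 : MvPolynomial τ k))
        ≤ ∑ b1 : Bool, complexity (if T b0 b1 then lit b0 u * lit b1 v else 0 : MvPolynomial τ k) +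
            (Finset.univ : Finset Bool).card := complexity_finset_sum_le _ _
      _ ≤ ∑ _b1 : Bool, (complexity u + complexity v + 5) + (Finset.univ : Finset Bool).card := by
          gcongr with b1; exact hterm b0 b1
      _ = 2 * (complexity u + complexity v + 5) + 2 := by
          simp only [Finset.sum_const, Finset.card_univ, Fintype.card_bool, smul_eq_mul, two_mul]
  calc complexity (∑ b0 : Bool, ∑ b1 : Bool, (if T b0 b1 then lit b0 u * lit b1 v else 0 : MvPolynomial τ k))
      ≤ ∑ b0 : Bool, complexity (∑ b1 : Bool, (if T b0 b1 then lit b0 u * lit b1 v else 0 : MvPolynomial τ k)) +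
          (Finset.univ : Finset Bool).card := complexity_finset_sum_le _ _
    _ ≤ ∑ _b0 : Bool, (2 * (complexity u + complexity v + 5) + 2) + (Finset.univ : Finset Bool).card := by
        gcongr with b0; exact hinner b0
    _ = 4 * (complexity u + complexity v) + 26 := by
        simp only [Finset.sum_const, Finset.card_univ, Fintype.card_bool, smul_eq_mul]; omega

/-- `L(eqInd y t) ≤ 2 (L y + L t) + 7`. [cite: Burgisser2000, Def. 2.1] -/
theorem complexity_eqInd_le (y t : MvPolynomial τ k) :
    complexity (eqInd y t) ≤ 2 * (complexity y + complexity t) + 7 := by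
  unfold eqInd
  calc complexity (y * t + (1 - y) * (1 - t))
      ≤ complexity (y * t) + complexity ((1 - y) * (1 - t)) + 1 := complexity_add_le_holds _ _
    _ ≤ (complexity y + complexity t + 1) + ((complexity y + 2) + (complexity t + 2) + 1) + 1 := by
        gcongr
        · exact complexity_mul_le_holds _ _
        · exact (complexity_mul_le_holds _ _).trans
            (Nat.add_le_add_right (Nat.add_le_add (complexity_one_sub_le _) (complexity_one_sub_le _)) 1)
    _ = 2 * (complexity y + complexity t) + 7 := by ring

/-- `deg (1 - p) ≤ deg p`. [folklore] -/
theorem totalDegree_one_sub_le (p : MvPolynomial τ k) : (1 - p).totalDegree ≤ p.totalDegree :=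
  (totalDegree_sub _ _).trans (max_le (by rw [totalDegree_one]; exact Nat.zero_le _) le_rfl)

/-- `deg (lit c p) ≤ deg p`. [folklore] -/
theorem totalDegree_lit_le (c : Bool) (p : MvPolynomial τ k) : (lit c p).totalDegree ≤ p.totalDegree := by
  unfold lit; cases c
  · exact totalDegree_one_sub_le p
  · exact le_rfl

/-- `deg (tableExt T u v) ≤ deg u + deg v`. [folklore] -/
theorem totalDegree_tableExt_le (T : Bool → Bool → Bool) (u v : MvPolynomial τ k) :
    (tableExt T u v).totalDegree ≤ u.totalDegree + v.totalDegree := by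
  unfold tableExt
  refine (totalDegree_finsetSum _ _).trans (Finset.sup_le fun b0 _ => ?_)
  refine (totalDegree_finsetSum _ _).trans (Finset.sup_le fun b1 _ => ?_)
  split_ifs
  · exact (totalDegree_mul _ _).trans (Nat.add_le_add (totalDegree_lit_le _ _) (totalDegree_lit_le _ _))
  · rw [totalDegree_zero]; exact Nat.zero_le _

/-- `deg (eqInd y t) ≤ deg y + deg t`. [folklore] -/
theorem totalDegree_eqInd_le (y t : MvPolynomial τ k) :
    (eqInd y t).totalDegree ≤ y.totalDegree + t.totalDegree := by
  unfold eqInd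
  refine (totalDegree_add _ _).trans (max_le (totalDegree_mul _ _) ?_)
  exact (totalDegree_mul _ _).trans (Nat.add_le_add (totalDegree_one_sub_le _) (totalDegree_one_sub_le _))

/-- The total degree of a variable is at most one (cf. `Literature.PNP.totalDegree_X_le_one` in
`ValiantConjectureProofs.lean`, the same one-liner; librarian: merge). [folklore] -/
theorem totalDegree_X_le_one' (s : τ) : (X s : MvPolynomial τ k).totalDegree ≤ 1 :=
  (isHomogeneous_X k s).totalDegree_le


/-! ### The arithmetization of a circuit -/

variable {ι : Type v}

/-- The polynomial of a wire: an input variable `X_i`, a gate variable `Y_m` (for `m < s`), or `0`. [cite: Burgisser2000, proof of Prop. 2.20] -/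
def wirePoly (s : ℕ) : ι ⊕ ℕ → MvPolynomial (ι ⊕ Fin s) k
  | .inl i => X (.inl i)
  | .inr m => if h : m < s then X (.inr ⟨m, h⟩) else 0

/-- The polynomial of argument `a` of a gate (`0` for a missing argument). [folklore] -/
def argPoly (s : ℕ) (g : Gate ι) (a : ℕ) : MvPolynomial (ι ⊕ Fin s) k :=
  if h : a < g.arity then wirePoly s (g.args ⟨a, h⟩) else 0

/-- The consistency polynomial of gate `j` of `Q`: `[Y_j = T_j(arg₀, arg₁)]` with `T_j` the binary
truth table of the gate. [cite: Burgisser2000, proof of Prop. 2.20] -/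
def consPoly (Q : Circuit ι) (j : Fin Q.size) : MvPolynomial (ι ⊕ Fin Q.size) k :=
  eqInd (X (.inr j)) (tableExt (btable (Q.gates[j.val]'j.isLt)) (argPoly Q.size (Q.gates[j.val]'j.isLt) 0)
    (argPoly Q.size (Q.gates[j.val]'j.isLt) 1))

/-- `VALID = ∏_j consPoly j`. [cite: Burgisser2000, proof of Prop. 2.20] -/
def validPoly (Q : Circuit ι) : MvPolynomial (ι ⊕ Fin Q.size) k :=
  ∏ j : Fin Q.size, consPoly Q j

/-- **The arithmetization** `arith Q = VALID · OUT`. [cite: Burgisser2000, proof of Prop. 2.20] -/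
def arith (Q : Circuit ι) : MvPolynomial (ι ⊕ Fin Q.size) k :=
  validPoly Q * wirePoly Q.size Q.output

/-! ### Evaluation at Boolean points -/

/-- The Boolean point `(b, y)`. [folklore] -/
def bpt (k : Type u) [CommRing k] {s : ℕ} (b : ι → Bool) (y : Fin s → Bool) : ι ⊕ Fin s → k :=
  Sum.elim (toK k ∘ b) (toK k ∘ y)

/-- The Boolean value of a wire under `(b, y)`. [folklore] -/
def bwval {s : ℕ} (b : ι → Bool) (y : Fin s → Bool) : ι ⊕ ℕ → Bool
  | .inl i => b i
  | .inr m => if h : m < s then y ⟨m, h⟩ else false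

/-- `bwval` is `wireVal` on the list `ofFn y`. [folklore] -/
theorem bwval_eq_wireVal {s : ℕ} (b : ι → Bool) (y : Fin s → Bool) (w : ι ⊕ ℕ) :
    bwval b y w = wireVal b (List.ofFn y) w := by
  cases w with
  | inl i => rfl
  | inr m =>
    simp only [bwval, wireVal, List.getD_eq_getElem?_getD, List.getElem?_ofFn]
    by_cases h : m < s <;> simp [h]

/-- A wire polynomial at a Boolean point. [folklore] -/
theorem eval_wirePoly {s : ℕ} (b : ι → Bool) (y : Fin s → Bool) (w : ι ⊕ ℕ) :
    eval (bpt k b y) (wirePoly s w) = toK k (bwval b y w) := by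
  cases w with
  | inl i => simp [wirePoly, bpt, bwval]
  | inr m => by_cases h : m < s <;> simp [wirePoly, bwval, bpt, h]

/-- The Boolean value of argument `a` of a gate. [folklore] -/
def bargval {s : ℕ} (b : ι → Bool) (y : Fin s → Bool) (g : Gate ι) (a : ℕ) : Bool :=
  if h : a < g.arity then bwval b y (g.args ⟨a, h⟩) else false

/-- An argument polynomial at a Boolean point. [folklore] -/
theorem eval_argPoly {s : ℕ} (b : ι → Bool) (y : Fin s → Bool) (g : Gate ι) (a : ℕ) :
    eval (bpt k b y) (argPoly s g a) = toK k (bargval b y g a) := by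
  unfold argPoly bargval
  split
  · exact eval_wirePoly b y _
  · simp

/-- The binary truth table applied to the argument values is the gate's value (fan-in `≤ 2`). [folklore] -/
theorem btable_bargval {s : ℕ} (b : ι → Bool) (y : Fin s → Bool) (g : Gate ι) (hg : g.arity ≤ 2) :
    btable g (bargval b y g 0) (bargval b y g 1) = g.op fun a => bwval b y (g.args a) := by
  unfold btable
  congr 1
  funext a
  rcases a with ⟨_ | _ | i, ha⟩
  · simp [bargval, ha]
  · simp [bargval, ha]
  · omega

/-- The consistency polynomial at a Boolean point: the indicator that the guessed value of gate
`j` is the gate applied to the (guessed or input) argument values. [cite: Burgisser2000, proof of Prop. 2.20] -/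
theorem eval_consPoly (Q : Circuit ι) (hQ : Q.IsOver B2) (b : ι → Bool)
    (y : Fin Q.size → Bool) (j : Fin Q.size) :
    eval (bpt k b y) (consPoly Q j) =
      toK k (y j == (Q.gates[j.val]'j.isLt).op fun a => bwval b y ((Q.gates[j.val]'j.isLt).args a)) := by
  unfold consPoly
  rw [← btable_bargval b y _ (hQ _ (List.getElem_mem _))]
  exact eval_eqInd _ _ _ (y j) _ (by simp [bpt])
    (eval_tableExt _ _ _ _ _ _ (eval_argPoly b y _ 0) (eval_argPoly b y _ 1))

/-- **`VALID` at a Boolean point is the indicator of the true transcript.** [cite: Burgisser2000, proof of Prop. 2.20] -/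
theorem eval_validPoly (Q : Circuit ι) (hQ : Q.IsOver B2) (b : ι → Bool) (y : Fin Q.size → Bool) :
    eval (bpt k b y) (validPoly Q) = toK k (decide (List.ofFn y = transcript b [] Q.gates)) := by
  unfold validPoly
  rw [map_prod]
  simp only [eval_consPoly Q hQ b y]
  -- the gate equations for `ofFn y`
  have hiff : (∀ j : Fin Q.size, y j = (Q.gates[j.val]'j.isLt).op fun a => bwval b y ((Q.gates[j.val]'j.isLt).args a)) ↔
      List.ofFn y = transcript b [] Q.gates := by
    have hgv : ∀ j : Fin Q.size, ((Q.gates[j.val]'j.isLt).op fun a => bwval b y ((Q.gates[j.val]'j.isLt).args a)) =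
        gateValue b (List.ofFn y) (Q.gates[j.val]'j.isLt) := fun j => by
      unfold gateValue; congr 1; funext a; exact bwval_eq_wireVal b y _
    simp only [hgv]
    constructor
    · intro h
      refine eq_transcript_of_gate_equations Q b (List.ofFn y) (List.length_ofFn) fun j hj => ?_
      have hj' : j < Q.size := hj
      rw [List.getD_eq_getElem _ _ (by simpa using hj'), List.getElem_ofFn]
      exact h ⟨j, hj'⟩
    · intro h j
      have := getD_transcript_eq_gateValue Q b j.val j.isLt
      rw [← h, List.getD_eq_getElem _ _ (by simp), List.getElem_ofFn] at this
      exact this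
  by_cases hall : ∀ j : Fin Q.size, y j = (Q.gates[j.val]'j.isLt).op fun a => bwval b y ((Q.gates[j.val]'j.isLt).args a)
  · rw [decide_eq_true (hiff.1 hall)]
    refine Finset.prod_eq_one fun j _ => ?_
    rw [show (y j == _) = true from beq_iff_eq.2 (hall j)]
    rfl
  · rw [decide_eq_false (fun h => hall (hiff.2 h))]
    push Not at hall
    obtain ⟨j, hj⟩ := hall
    refine Finset.prod_eq_zero (Finset.mem_univ j) ?_
    rw [show (y j == _) = false from beq_eq_false_iff_ne.2 hj]
    rfl

/-- `arith Q` at a Boolean point. [cite: Burgisser2000, proof of Prop. 2.20] -/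
theorem eval_arith (Q : Circuit ι) (hQ : Q.IsOver B2) (b : ι → Bool) (y : Fin Q.size → Bool) :
    eval (bpt k b y) (arith Q) =
      toK k (decide (List.ofFn y = transcript b [] Q.gates)) * toK k (bwval b y Q.output) := by
  rw [arith, map_mul, eval_validPoly Q hQ b y, eval_wirePoly]

/-- **The transcript sum** (Valiant's criterion, core identity): for every Boolean input `b`,
`∑_{y ∈ {0,1}^{|Q|}} arith Q (b, y) = [Q(b)]`. [cite: Burgisser2000, Prop. 2.20] -/
theorem sum_eval_arith (Q : Circuit ι) (hQ : Q.IsOver B2) (b : ι → Bool) :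
    ∑ y : Fin Q.size → Bool, eval (bpt k b y) (arith Q) = toK k (Q.eval b) := by
  classical
  set W := transcript b [] Q.gates with hW
  have hlenW : W.length = Q.size := by rw [hW, length_transcript]; simp [Circuit.size]
  -- the true transcript as a function
  set y₀ : Fin Q.size → Bool := fun j => W[j.val]'(by rw [hlenW]; exact j.isLt) with hy₀
  have hy₀W : List.ofFn y₀ = W := by
    apply List.ext_getElem (by simp [hlenW])
    intro i h1 h2
    rw [List.getElem_ofFn]
  have huniq : ∀ y : Fin Q.size → Bool, List.ofFn y = W ↔ y = y₀ := by
    intro y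
    constructor
    · intro h
      funext j
      have := congrArg (fun l => l[j.val]?) h
      simp only [List.getElem?_ofFn, j.isLt] at this
      rw [hy₀]
      simp only
      rw [List.getElem?_eq_getElem (by rw [hlenW]; exact j.isLt)] at this
      simpa using this
    · rintro rfl; exact hy₀W
  simp only [eval_arith Q hQ b]
  rw [Finset.sum_eq_single y₀]
  · rw [decide_eq_true hy₀W, toK_true, one_mul, eval_eq_wireVal, bwval_eq_wireVal, hy₀W]
  · intro y _ hy
    rw [decide_eq_false (fun h => hy ((huniq y).1 h)), toK_false, zero_mul]
  · intro h; exact absurd (Finset.mem_univ y₀) h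

/-- **The criterion in `boolSum` form**: the Boolean sum (`ValiantClasses.boolSum`) of
`arith Q` over its gate variables, evaluated at the Boolean input `b`, is `[Q(b)]`. [cite: Burgisser2000, Prop. 2.20] -/
theorem eval_boolSum_arith (Q : Circuit ι) (hQ : Q.IsOver B2) (b : ι → Bool) :
    eval (toK k ∘ b) (boolSum (arith Q)) = toK k (Q.eval b) := by
  unfold boolSum
  rw [map_sum, ← sum_eval_arith Q hQ b]
  refine Finset.sum_congr rfl fun y _ => ?_
  rw [aeval_eq_bind₁, show eval (toK k ∘ b) (bind₁ (Sum.elim X fun j => if y j then 1 else 0) (arith Q)) =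
    eval (fun i => eval (toK k ∘ b) (Sum.elim X (fun j => if y j then 1 else 0) i)) (arith Q) from
      eval₂Hom_bind₁ _ _ _ _]
  congr 2
  funext i
  cases i with
  | inl i => simp [bpt]
  | inr j => cases y j <;> simp [bpt, toK]

/-! ### Size and degree -/

/-- `L(0) = 0`. [cite: Burgisser2000, Def. 2.1] -/
theorem complexity_zero' {σ : Type*} : complexity (0 : MvPolynomial σ k) = 0 := by
  have h := complexity_C_holds (σ := σ) (0 : k)
  rwa [C_0] at h

/-- Wire polynomials are free. [cite: Burgisser2000, Def. 2.1] -/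
theorem complexity_wirePoly {s : ℕ} (w : ι ⊕ ℕ) : complexity (wirePoly (k := k) s w) = 0 := by
  cases w with
  | inl i => exact complexity_X_holds _
  | inr m =>
    by_cases h : m < s
    · simp only [wirePoly, h, ↓reduceDIte]; exact complexity_X_holds _
    · simp only [wirePoly, h, ↓reduceDIte]; exact complexity_zero'

/-- Argument polynomials are free. [cite: Burgisser2000, Def. 2.1] -/
theorem complexity_argPoly {s : ℕ} (g : Gate ι) (a : ℕ) : complexity (argPoly (k := k) s g a) = 0 := by
  unfold argPoly; split
  · exact complexity_wirePoly _
  · exact complexity_zero'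

/-- `L(consPoly j) ≤ 59`. [cite: Burgisser2000, Def. 2.1] -/
theorem complexity_consPoly_le (Q : Circuit ι) (j : Fin Q.size) : complexity (consPoly (k := k) Q j) ≤ 59 := by
  unfold consPoly
  refine (complexity_eqInd_le _ _).trans ?_
  rw [complexity_X_holds]
  have h := complexity_tableExt_le (k := k) (btable (Q.gates[j.val]'j.isLt)) (argPoly Q.size (Q.gates[j.val]'j.isLt) 0)
    (argPoly Q.size (Q.gates[j.val]'j.isLt) 1)
  rw [complexity_argPoly, complexity_argPoly] at h
  omega

/-- **`L(arith Q) ≤ 60 |Q| + 1`.** [cite: Burgisser2000, Prop. 2.20 (g ∈ VP)] -/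
theorem complexity_arith_le (Q : Circuit ι) : complexity (arith (k := k) Q) ≤ 60 * Q.size + 1 := by
  unfold arith validPoly
  refine (complexity_mul_le_holds _ _).trans ?_
  rw [complexity_wirePoly, add_zero]
  refine Nat.add_le_add_right ((complexity_finset_prod_le _ _).trans ?_) 1
  calc ∑ j : Fin Q.size, complexity (consPoly (k := k) Q j) + (Finset.univ : Finset (Fin Q.size)).card
      ≤ ∑ _j : Fin Q.size, 59 + (Finset.univ : Finset (Fin Q.size)).card := by
        gcongr with j; exact complexity_consPoly_le Q j
    _ = 60 * Q.size := by simp only [Finset.sum_const, Finset.card_univ, Fintype.card_fin, smul_eq_mul]; omega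

/-- Wire polynomials have degree `≤ 1`. [folklore] -/
theorem totalDegree_wirePoly_le {s : ℕ} (w : ι ⊕ ℕ) : (wirePoly (k := k) s w).totalDegree ≤ 1 := by
  cases w with
  | inl i => exact (totalDegree_X_le_one' (k := k) _)
  | inr m =>
    by_cases h : m < s
    · simp only [wirePoly, h, ↓reduceDIte]; exact totalDegree_X_le_one' (k := k) _
    · simp only [wirePoly, h, ↓reduceDIte, totalDegree_zero]; exact Nat.zero_le _

/-- Argument polynomials have degree `≤ 1`. [folklore] -/
theorem totalDegree_argPoly_le {s : ℕ} (g : Gate ι) (a : ℕ) : (argPoly (k := k) s g a).totalDegree ≤ 1 := by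
  unfold argPoly; split
  · exact totalDegree_wirePoly_le _
  · rw [totalDegree_zero]; exact Nat.zero_le _

/-- `deg (consPoly j) ≤ 3`. [folklore] -/
theorem totalDegree_consPoly_le (Q : Circuit ι) (j : Fin Q.size) : (consPoly (k := k) Q j).totalDegree ≤ 3 := by
  unfold consPoly
  refine (totalDegree_eqInd_le _ _).trans ?_
  have h1 := totalDegree_X_le_one' (k := k) (Sum.inr j : ι ⊕ Fin Q.size)
  have h2 := (totalDegree_tableExt_le (k := k) (btable (Q.gates[j.val]'j.isLt)) (argPoly Q.size (Q.gates[j.val]'j.isLt) 0)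
    (argPoly Q.size (Q.gates[j.val]'j.isLt) 1)).trans (Nat.add_le_add (totalDegree_argPoly_le _ _) (totalDegree_argPoly_le _ _))
  omega

/-- **`deg (arith Q) ≤ 3 |Q| + 1`.** [cite: Burgisser2000, Prop. 2.20 (g ∈ VP)] -/
theorem totalDegree_arith_le (Q : Circuit ι) : (arith (k := k) Q).totalDegree ≤ 3 * Q.size + 1 := by
  unfold arith validPoly
  refine (totalDegree_mul _ _).trans (Nat.add_le_add ?_ (totalDegree_wirePoly_le _))
  refine (totalDegree_finsetProd _ _).trans ?_
  calc ∑ j : Fin Q.size, (consPoly (k := k) Q j).totalDegree ≤ ∑ _j : Fin Q.size, 3 :=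
        Finset.sum_le_sum fun j _ => totalDegree_consPoly_le Q j
    _ = 3 * Q.size := by simp [mul_comm]

end CircuitArith

end Literature.Computability.AlgebraicComplexity
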